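import Summits.AtomisticToContinuum.Crystallization.Theorems.ChargedEnergyGapTileUnitA
import HarnessLib

/-!
# ChargedEnergyGap · 113M «TileUnit» (transverse-tiled frame units; lens-3 g96 ed.2) — part B (sequel of `…ChargedEnergyGapTileUnitA`)

Split for the 400-line cap by the landing lane (hand-2 g49); the module docstring of part A describes the whole node.  Same namespace; all FQNs unchanged.
0 sorry; standard axioms.
-/


namespace Summit.AtomisticToContinuum.Crystallization.Theorems.ChargedEnergyGapChartDial
open scoped Classical
open Literature.MathematicalPhysics.StatisticalMechanics Literature.Geometry.DiscreteGeometry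
open Summit.AtomisticToContinuum.Crystallization.Theses.PricedLinkCensus
open Summit.AtomisticToContinuum.Crystallization.Theorems.ChargedEnergyGapNegative

/-! ## §113M.3 Tiles, representatives, the tile unit -/
section Unit

/-- A TILE: one complete cell station on ITS OWN box — a 113B/113D station certificate (H-description whose box IS the tile, unit, cap
data, LP bases, box leaves, BSP tree, leaf caps), its diet rows and its slim bases. -/
structure Tile where
  /-- the tile's station certificate (its `R` is the tile's own H-description) -/
  st : StationCert
  /-- the tile's diet certificate (113B) -/
  X : DietCert
  /-- the tile's slim bases (the argument of 113L `checkDXZ`) -/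
  slim : List BasisIdx

/-- ★ THE TILE CHECKER: the tile lives on the unit's slab with the unit's `u` (three equalities of rationals) and its station passes the
113L flat checker `checkDXZ` with the nine rows of `cell`. -/
def Tile.check (t : Tile) (rho0 rho1 u : ℚ) (cell : Box3) : Bool :=
  decide (t.st.R.rho0 = rho0 ∧ t.st.R.rho1 = rho1 ∧ t.st.u = u) && t.st.checkDXZ t.X (sphRows cell t.st.R.rho0 t.st.R.rho1) t.slim

/-- A REPRESENTATIVE CELL with its own tiling: the direction cell, the half-domain flag (set only for a SELF-MIRROR cell: the tiles then
need cover the tuples with `T₁ ≤ T₂` only), the tiles, and the cover certificate of the frame box by the tile boxes. -/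
structure Rep where
  /-- the direction cell (113E) -/
  cell : Box3
  /-- half-domain flag (self-mirror cells only) -/
  half : Bool
  /-- the tiles -/
  tiles : List Tile
  /-- the cover certificate of the frame box by the tile boxes -/
  tcover : TileTree

/-- The tile boxes of a representative (in tile order). -/
def Rep.boxes (P : Rep) : List RBox := P.tiles.map (fun t => t.st.R.rbox)

/-- ★ THE REPRESENTATIVE CHECKER against the frame `F` and the unit `u`: the half flag is licensed (cell self-mirror), the tile boxes
cover the frame box (`TileTree.check`), every tile checks with the cell's rows. -/
def Rep.check (P : Rep) (F : StationRowsCert) (u : ℚ) : Bool :=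
  (!P.half || decide (P.cell.l1 = P.cell.l2 ∧ P.cell.h1 = P.cell.h2)) && P.tcover.check P.boxes P.half F.rbox &&
    P.tiles.all (fun t => t.check F.rho0 F.rho1 u P.cell)

/-- [formal bookkeeping] ASSEMBLY of a representative's check from its three decisions (the flag, the cover, the tiles). -/
theorem Rep.check_of {P : Rep} {F : StationRowsCert} {u : ℚ} (h1 : (!P.half || decide (P.cell.l1 = P.cell.l2 ∧ P.cell.h1 = P.cell.h2)) = true)
    (h2 : P.tcover.check P.boxes P.half F.rbox = true) (h3 : P.tiles.all (fun t => t.check F.rho0 F.rho1 u P.cell) = true) :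
    P.check F u = true := by
  unfold Rep.check
  rw [h1, h2, h3]
  rfl

/-- ★★ TILE DISPATCH: a checked representative proves the (T¹ᶜ) inequality for every FNF chamber tuple of the frame's slab × box whose
centre direction satisfies the nine inequalities of its cell — and, when `half`, with `T₁ ≤ T₂` — by `TileTree.check_sound` (some tile box
contains the tuple's seven depths) and 113L `sphLaw_of_checkDXZ` for that tile's station. -/
theorem Rep.soundD (P : Rep) (F : StationRowsCert) (u : ℚ) (h : P.check F u = true) :
    ∀ ρ : ℝ, (F.rho0 : ℝ) ≤ ρ → ρ ≤ F.rho1 → ∀ dt : (Fin 3 → ℤ) → ℝ,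
      (P.half = true → dt (holeVertex 0 (1, true)) ≤ dt (holeVertex 0 (2, true))) →
      (∀ q, castW F.lo q ≤ dt (holeVertex 0 q) ∧ dt (holeVertex 0 q) ≤ castW F.hi q) → ((F.loC : ℝ) ≤ dt 0 ∧ dt 0 ≤ F.hiC) →
      IsChartRealisable ρ dt → (∀ p ∈ stencil 0, 0 < dt p) → poleSum dt 0 ≤ poleSum dt 1 → poleSum dt 0 ≤ poleSum dt 2 →
      (∀ a : Fin 3, dt (holeVertex 0 (a, true)) ≤ dt (holeVertex 0 (a, false))) →
      (∀ a : Fin 3, dt (holeVertex 0 (a, true)) ^ 2 - dt 0 ^ 2 + 2 * (P.cell.lo a : ℝ) * F.rho0 * dt 0 ≤ (F.rho1 : ℝ) ^ 2) →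
      (∀ (a : Fin 3) (b : Bool), dt (holeVertex 0 (a, b)) ^ 2 - dt 0 ^ 2 - 2 * (P.cell.hi a : ℝ) * F.rho1 * dt 0 ≤ (F.rho1 : ℝ) ^ 2) →
      feetHoleCost 160 (3 / 100) ρ dt 0 ≤ domCapK u 160 (3 / 100) ρ (chargeDepth ρ dt 0) := by
  simp only [Rep.check, Bool.and_eq_true, List.all_eq_true] at h
  obtain ⟨⟨-, hT⟩, hall⟩ := h
  intro ρ h₀ h₁ dt hhalf hbox hC hreal hpos hch1 hch2 hchp hlo hhi
  obtain ⟨T, hTm, hbT, hcT⟩ := P.tcover.check_sound P.boxes P.half _ hT dt hbox hC hch1 hch2 hchp hhalf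
  obtain ⟨t, ht, rfl⟩ := List.mem_map.1 hTm
  have hchk := hall t ht
  simp only [Tile.check, Bool.and_eq_true, decide_eq_true_eq] at hchk
  obtain ⟨⟨e0, e1, eu⟩, hz⟩ := hchk
  have H := t.st.sphLaw_of_checkDXZ t.X P.cell t.slim hz
  rw [e0, e1, eu] at H
  exact H ρ h₀ h₁ dt hbT hcT hreal hpos hch1 hch2 hchp hlo hhi

/-- ★★ THE REPRESENTATIVE'S SPHERE-CELL LAW (no half-domain condition left): over a `1 ↔ 2`-symmetric frame with `0 < ρ0`, a checked
representative proves the (T¹ᶜ) inequality for every FNF chamber tuple of the frame's slab × box whose direction lies in its cell — when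
`half`, a tuple with `T₂ < T₁` is the relabelling of one with `T₁ ≤ T₂` whose direction lies in `cell.swap12 = cell` (`lawR_swap12`). -/
theorem Rep.sound (P : Rep) (F : StationRowsCert) (u : ℚ) (h : P.check F u = true) (hs : F.symm12 = true) (hρ0 : 0 < F.rho0) :
    ∀ ρ : ℝ, (F.rho0 : ℝ) ≤ ρ → ρ ≤ F.rho1 → ∀ dt : (Fin 3 → ℤ) → ℝ,
      (∀ q, castW F.lo q ≤ dt (holeVertex 0 q) ∧ dt (holeVertex 0 q) ≤ castW F.hi q) → ((F.loC : ℝ) ≤ dt 0 ∧ dt 0 ≤ F.hiC) →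
      IsChartRealisable ρ dt → (∀ p ∈ stencil 0, 0 < dt p) → poleSum dt 0 ≤ poleSum dt 1 → poleSum dt 0 ≤ poleSum dt 2 →
      (∀ a : Fin 3, dt (holeVertex 0 (a, true)) ≤ dt (holeVertex 0 (a, false))) →
      (∀ a : Fin 3, dt (holeVertex 0 (a, true)) ^ 2 - dt 0 ^ 2 + 2 * (P.cell.lo a : ℝ) * F.rho0 * dt 0 ≤ (F.rho1 : ℝ) ^ 2) →
      (∀ (a : Fin 3) (b : Bool), dt (holeVertex 0 (a, b)) ^ 2 - dt 0 ^ 2 - 2 * (P.cell.hi a : ℝ) * F.rho1 * dt 0 ≤ (F.rho1 : ℝ) ^ 2) →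
      feetHoleCost 160 (3 / 100) ρ dt 0 ≤ domCapK u 160 (3 / 100) ρ (chargeDepth ρ dt 0) := by
  intro ρ h₀ h₁ dt hbox hC hreal hpos hch1 hch2 hchp hlo hhi
  cases hP : P.half with
  | false => exact P.soundD F u h ρ h₀ h₁ dt (by simp [hP]) hbox hC hreal hpos hch1 hch2 hchp hlo hhi
  | true =>
    rcases le_or_gt (dt (holeVertex 0 (1, true))) (dt (holeVertex 0 (2, true))) with hle | hgt
    · exact P.soundD F u h ρ h₀ h₁ dt (fun _ => hle) hbox hC hreal hpos hch1 hch2 hchp hlo hhi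
    · have hc' : P.cell.l1 = P.cell.l2 ∧ P.cell.h1 = P.cell.h2 := by
        simp only [Rep.check, Bool.and_eq_true] at h
        simpa [hP] using h.1.1
      have hcell : P.cell.swap12 = P.cell := Box3.swap12_eq_self hc'.1 hc'.2
      have H := lawR_swap12 (fun d => d (holeVertex 0 (1, true)) ≤ d (holeVertex 0 (2, true)))
        (fun ρ' g₀ g₁ d hS => P.soundD F u h ρ' g₀ g₁ d (fun _ => hS)) hs hρ0
      rw [hcell] at H
      refine H ρ h₀ h₁ dt ?_ hbox hC hreal hpos hch1 hch2 hchp hlo hhi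
      show tupleRelabel 1 0 dt (holeVertex 0 (1, true)) ≤ tupleRelabel 1 0 dt (holeVertex 0 (2, true))
      rw [tupleRelabel_vertex, tupleRelabel_vertex, relabel_one_zero, relabel_one_zero, axp_one.2.1, axp_one.2.2]
      exact hgt.le

/-- ★ A TILE UNIT: the FRAME (slab and frame box of `R`: slot-`0` window × the band's full transverse extent × centre band; its row lists
are not read), the unit `u` of `domCapK`, the cover of the direction sphere (113E) certified against the representatives' cells and their
mirrors, and the representatives with their own tilings. -/
structure TileUnit where
  /-- the frame (slab + frame box; row lists unread) -/
  R : StationRowsCert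
  /-- the unit of `domCapK` -/
  u : ℚ
  /-- the cover of the direction sphere (113E) -/
  cover : CoverTree
  /-- the representatives -/
  reps : List Rep

/-- The representatives' cells (in order). -/
def TileUnit.cells (U : TileUnit) : List Box3 := U.reps.map Rep.cell

/-- The DOUBLED cell list (113I): the representatives' cells, then their mirrors. -/
def TileUnit.cellsM (U : TileUnit) : List Box3 := U.cells ++ U.cells.map Box3.swap12

/-- ★ THE TILE UNIT CHECKER (shape of 113I/113L `checkM`): the sphere cover checks against the doubled cell list, the doubled cells have
nonnegative lower corners, `0 < ρ0`, the FRAME box is `1 ↔ 2`-symmetric, every representative checks against the frame. -/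
def TileUnit.checkM (U : TileUnit) : Bool :=
  U.cover.check U.cellsM unitCube && U.cellsM.all (fun c => decide (0 ≤ c.l0 ∧ 0 ≤ c.l1 ∧ 0 ≤ c.l2)) && decide (0 < U.R.rho0) && U.R.symm12 &&
    U.reps.all (fun P => P.check U.R U.u)

/-- [formal bookkeeping] ASSEMBLY of a unit's check from its decisions (cover, corners, slab, symmetry, representatives). -/
theorem TileUnit.checkM_of {U : TileUnit} (h1 : U.cover.check U.cellsM unitCube = true)
    (h2 : U.cellsM.all (fun c => decide (0 ≤ c.l0 ∧ 0 ≤ c.l1 ∧ 0 ≤ c.l2)) = true) (h3 : decide (0 < U.R.rho0) = true) (h4 : U.R.symm12 = true)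
    (h5 : U.reps.all (fun P => P.check U.R U.u) = true) : U.checkM = true := by
  unfold TileUnit.checkM
  rw [h1, h2, h3, h4, h5]
  rfl

/-- ★★★ **SOUNDNESS OF A TILE UNIT** — the binders and the conclusion of 113F `SphUnit.sound` / 113L `ZUnit.soundM` EXACTLY (frame `U.R`,
unit `U.u`): the (T¹ᶜ) inequality for EVERY chart-realisable positive tuple of the frame's slab × box in the axis-`0` chamber, no cell and
no tile hypothesis left — 113E `sphere_cells_dispatch` over the doubled cell list; a representative's cell by `Rep.sound`, a mirror cell by
`lawR_swap12` applied to `Rep.sound`. -/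
theorem TileUnit.soundM (U : TileUnit) (h : U.checkM = true) :
    ∀ ρ : ℝ, (U.R.rho0 : ℝ) ≤ ρ → ρ ≤ U.R.rho1 → ∀ dt : (Fin 3 → ℤ) → ℝ,
      (∀ q, castW U.R.lo q ≤ dt (holeVertex 0 q) ∧ dt (holeVertex 0 q) ≤ castW U.R.hi q) → ((U.R.loC : ℝ) ≤ dt 0 ∧ dt 0 ≤ U.R.hiC) →
      IsChartRealisable ρ dt → (∀ p ∈ stencil 0, 0 < dt p) → poleSum dt 0 ≤ poleSum dt 1 → poleSum dt 0 ≤ poleSum dt 2 →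
      (∀ a : Fin 3, dt (holeVertex 0 (a, true)) ≤ dt (holeVertex 0 (a, false))) →
      feetHoleCost 160 (3 / 100) ρ dt 0 ≤ domCapK U.u 160 (3 / 100) ρ (chargeDepth ρ dt 0) := by
  simp only [TileUnit.checkM, Bool.and_eq_true, decide_eq_true_eq] at h
  obtain ⟨⟨⟨⟨hT, hnn⟩, hρ0⟩, hs⟩, hall⟩ := h
  intro ρ h₀ h₁ dt hbox hC hreal hpos hch1 hch2 hchp
  obtain ⟨c, hc, hlo, hhi⟩ := sphere_cells_dispatch U.cellsM U.cover hT hnn hreal h₀ h₁ (by exact_mod_cast hρ0.le) hpos hchp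
  rcases List.mem_append.1 hc with hc | hc
  · obtain ⟨P, hP, rfl⟩ := List.mem_map.1 hc
    exact P.sound U.R U.u (List.all_eq_true.mp hall P hP) hs hρ0 ρ h₀ h₁ dt hbox hC hreal hpos hch1 hch2 hchp hlo hhi
  · obtain ⟨c', hc', rfl⟩ := List.mem_map.1 hc
    obtain ⟨P, hP, rfl⟩ := List.mem_map.1 hc'
    exact lawR_swap12 (fun _ => True) (fun ρ' g₀ g₁ d _ => P.sound U.R U.u (List.all_eq_true.mp hall P hP) hs hρ0 ρ' g₀ g₁ d) hs hρ0
      ρ h₀ h₁ dt trivial hbox hC hreal hpos hch1 hch2 hchp hlo hhi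

/-- ★ BATCH FORM over a list of checked tile units. -/
theorem TileUnit.soundM_of_all {Us : List TileUnit} (h : Us.all TileUnit.checkM = true) {U : TileUnit} (hU : U ∈ Us) :
    ∀ ρ : ℝ, (U.R.rho0 : ℝ) ≤ ρ → ρ ≤ U.R.rho1 → ∀ dt : (Fin 3 → ℤ) → ℝ,
      (∀ q, castW U.R.lo q ≤ dt (holeVertex 0 q) ∧ dt (holeVertex 0 q) ≤ castW U.R.hi q) → ((U.R.loC : ℝ) ≤ dt 0 ∧ dt 0 ≤ U.R.hiC) →
      IsChartRealisable ρ dt → (∀ p ∈ stencil 0, 0 < dt p) → poleSum dt 0 ≤ poleSum dt 1 → poleSum dt 0 ≤ poleSum dt 2 →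
      (∀ a : Fin 3, dt (holeVertex 0 (a, true)) ≤ dt (holeVertex 0 (a, false))) →
      feetHoleCost 160 (3 / 100) ρ dt 0 ≤ domCapK U.u 160 (3 / 100) ρ (chargeDepth ρ dt 0) :=
  U.soundM (List.all_eq_true.mp h U hU)

/-- ★ MUST-FAIL, STRUCTURALLY: a representative whose cover certificate does not check (e.g. its tiles do not cover the frame box) fails
`Rep.check`, whatever its tiles certify. -/
theorem Rep.check_eq_false_of_cover {P : Rep} {F : StationRowsCert} {u : ℚ} (h : P.tcover.check P.boxes P.half F.rbox = false) :
    P.check F u = false := by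
  unfold Rep.check
  rw [h, Bool.and_false, Bool.false_and]

/-- ★ MUST-FAIL, STRUCTURALLY: a unit with ONE failing representative fails `checkM` — a tile unit whose tiles do not cover its declared
frame is rejected by the kernel, not by the reader. -/
theorem TileUnit.checkM_eq_false_of_rep {U : TileUnit} {P : Rep} (hP : P ∈ U.reps) (h : P.check U.R U.u = false) : U.checkM = false := by
  cases hU : U.checkM with
  | false => rfl
  | true =>
    exfalso
    simp only [TileUnit.checkM, Bool.and_eq_true] at hU
    have := List.all_eq_true.mp hU.2 P hP
    rw [h] at this
    exact Bool.false_ne_true this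

/-- ★ CONSUMING A LANDED 113L UNIT BY NAME: the flat part of a `ZUnit` for one cell IS a tile (the unit's shared H-description is the tile box,
its shared diet certificate and the part's bases / leaves / tree / caps / slim bases the tile's station). -/
def ZUnit.tile (Z : ZUnit) (P : ZPart) : Tile := ⟨Z.station P.part, Z.X, P.slim⟩

/-- ★★ … and its tile check is READ OFF the landed `checkM` (no decision re-run): every diagonal unit of batches 3–4 (`U_ok : U.checkM = true`)
supplies, per part, a checked tile over its own box for a 113M representative on the same slab, unit and cell. -/
theorem ZUnit.tile_check (Z : ZUnit) (h : Z.checkM = true) {P : ZPart} (hP : P ∈ Z.parts) :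
    (Z.tile P).check Z.R.rho0 Z.R.rho1 Z.u P.part.cell = true := by
  simp only [ZUnit.checkM, Bool.and_eq_true] at h
  have hz := List.all_eq_true.mp h.2 P hP
  unfold Tile.check
  rw [Bool.and_eq_true]
  exact ⟨decide_eq_true ⟨rfl, rfl, rfl⟩, hz⟩

/-- [formal bookkeeping] the same from the plain (non-mirror) 113L check. -/
theorem ZUnit.tile_check' (Z : ZUnit) (h : Z.check = true) {P : ZPart} (hP : P ∈ Z.parts) :
    (Z.tile P).check Z.R.rho0 Z.R.rho1 Z.u P.part.cell = true := by
  simp only [ZUnit.check, Bool.and_eq_true] at h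
  have hz := List.all_eq_true.mp h.2 P hP
  unfold Tile.check
  rw [Bool.and_eq_true]
  exact ⟨decide_eq_true ⟨rfl, rfl, rfl⟩, hz⟩

/-- [formal bookkeeping] ASSEMBLY of a representative's tile conjunct one tile at a time (a landed tile by `ZUnit.tile_check`, a new tile
by `decide +kernel`). -/
theorem Tile.all_check_cons {t : Tile} {ts : List Tile} {rho0 rho1 u : ℚ} {cell : Box3} (h1 : t.check rho0 rho1 u cell = true)
    (h2 : ts.all (fun t' => t'.check rho0 rho1 u cell) = true) : (t :: ts).all (fun t' => t'.check rho0 rho1 u cell) = true := by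
  rw [List.all_cons, h1, h2, Bool.and_self]

end Unit

/-! ## §113M.4 Finite checks on a toy frame: diagonal quarters do not cover, semi-quarters do -/
section Sanity

/-- TOY FRAME: slot-`0` window `[10, 11]²`, transverse extent `T ∈ [10, 14]`, `F ∈ [10, 18]` on both axes, centre `[10, 11]`. -/
def toyFrame : RBox := ⟨sextQ 10 10 10 10 10 10, sextQ 11 11 14 18 14 18, 10, 11⟩

/-- A toy DIAGONAL QUARTER (the tiling of record): `T₁, T₂ ∈ [t0, t1]` and `F₁, F₂ ∈ [f0, f1]` together. -/
def toyQuarter (t0 t1 f0 f1 : ℚ) : RBox := ⟨sextQ 10 10 t0 f0 t0 f0, sextQ 11 11 t1 f1 t1 f1, 10, 11⟩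

/-- A toy SEMI-QUARTER: axis `1` in `[t0, t1] × [f0, f1]`, axis `2` free over the frame's extent. -/
def toySemi (t0 t1 f0 f1 : ℚ) : RBox := ⟨sextQ 10 10 t0 f0 10 10, sextQ 11 11 t1 f1 14 18, 10, 11⟩

/-- The toy chamber point with MIXED transverse halves, as a degenerate box: `x_{0,T} = x_{0,F} = 10`, `T₁ = 11`, `F₁ = 13` (lower halves),
`T₂ = 13`, `F₂ = 15` (upper halves), centre `21/2`; it lies in the frame, has `T_a ≤ F_a` and pole sums `20 ≤ 24, 28`. -/
def toyPoint : RBox := ⟨sextQ 10 10 11 13 13 15, sextQ 10 10 11 13 13 15, 21 / 2, 21 / 2⟩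

/-- [finite check] the toy point lies in the toy frame … -/
example : toyPoint.inside toyFrame = true := by decide +kernel

/-- [finite check] … and in NONE of the four diagonal quarters: their union is not the frame's chamber part. -/
example : ([toyQuarter 10 12 10 14, toyQuarter 10 12 14 18, toyQuarter 12 14 10 14, toyQuarter 12 14 14 18] : List RBox).all
    (fun T => !(toyPoint.inside T)) = true := by
  decide +kernel

/-- [finite check] the four SEMI-QUARTERS pass the tile cover check of the toy frame (axis `1` split at `T = 12`, `F = 14`; axis `2` free). -/
example : (TileTree.split (1, true) 12 (TileTree.split (1, false) 14 (TileTree.tile 0) (TileTree.tile 1))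
      (TileTree.split (1, false) 14 (TileTree.tile 2) (TileTree.tile 3))).check
    [toySemi 10 12 10 14, toySemi 10 12 14 18, toySemi 12 14 10 14, toySemi 12 14 14 18] false toyFrame = true := by
  decide +kernel

/-- [finite check] an `offTF` leaf discards the part `T₁ ≥ 13` of the semi-quarter with `F₁ ≤ 12`, so a NARROWER tile suffices there
(axis `1`: `T ∈ [10, 13]`, `F ∈ [10, 12]`). -/
example : (TileTree.split (1, false) 12 (TileTree.split (1, true) 13 (TileTree.tile 0) (TileTree.offTF 1)) (TileTree.tile 1)).check
    [toySemi 10 13 10 12, toySemi 10 14 12 18] false toyFrame = true := by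
  decide +kernel

/-- [finite check, MUST-FAIL] the natural tree over the four DIAGONAL QUARTERS (the tiling of record) does NOT check: after the axis-`1`
splits the node boxes still have axis `2` at full extent, inside no diagonal quarter. -/
example : (TileTree.split (1, true) 12 (TileTree.split (1, false) 14 (TileTree.tile 0) (TileTree.tile 1))
      (TileTree.split (1, false) 14 (TileTree.tile 2) (TileTree.tile 3))).check
    [toyQuarter 10 12 10 14, toyQuarter 10 12 14 18, toyQuarter 12 14 10 14, toyQuarter 12 14 14 18] false toyFrame = false := by
  decide +kernel

/-- [finite check, MUST-FAIL] … nor after splitting axis `2` as well at the same cuts (16 nodes, only the 4 diagonal ones have a tile): the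
twelve MIXED nodes name no tile. -/
example : (TileTree.split (1, true) 12
      (TileTree.split (1, false) 14
        (TileTree.split (2, true) 12 (TileTree.split (2, false) 14 (TileTree.tile 0) (TileTree.tile 4))
          (TileTree.split (2, false) 14 (TileTree.tile 4) (TileTree.tile 4)))
        (TileTree.split (2, true) 12 (TileTree.split (2, false) 14 (TileTree.tile 4) (TileTree.tile 1))
          (TileTree.split (2, false) 14 (TileTree.tile 4) (TileTree.tile 4))))
      (TileTree.split (1, false) 14
        (TileTree.split (2, true) 12 (TileTree.split (2, false) 14 (TileTree.tile 4) (TileTree.tile 4))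
          (TileTree.split (2, false) 14 (TileTree.tile 2) (TileTree.tile 4)))
        (TileTree.split (2, true) 12 (TileTree.split (2, false) 14 (TileTree.tile 4) (TileTree.tile 4))
          (TileTree.split (2, false) 14 (TileTree.tile 4) (TileTree.tile 3))))).check
    [toyQuarter 10 12 10 14, toyQuarter 10 12 14 18, toyQuarter 12 14 10 14, toyQuarter 12 14 14 18] false toyFrame = false := by
  decide +kernel

/-- [finite check, MUST-FAIL] deleting ONE semi-quarter (here: shrinking the fourth to `F₁ ≤ 17 < 18`) makes the semi-quarter cover fail. -/
example : (TileTree.split (1, true) 12 (TileTree.split (1, false) 14 (TileTree.tile 0) (TileTree.tile 1))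
      (TileTree.split (1, false) 14 (TileTree.tile 2) (TileTree.tile 3))).check
    [toySemi 10 12 10 14, toySemi 10 12 14 18, toySemi 12 14 10 14, toySemi 12 14 14 17] false toyFrame = false := by
  decide +kernel

/-- [finite check, MUST-FAIL] the `offHalf` leaf is refused when the half-domain flag is off … -/
example : (TileTree.split (2, true) 11 TileTree.offHalf (TileTree.tile 0)).check [toySemi 10 14 10 18] false
    ⟨sextQ 10 10 12 10 10 10, sextQ 11 11 14 18 14 18, 10, 11⟩ = false := by
  decide +kernel

/-- [finite check] … and accepted when it is on (node `T₂ ≤ 11 < 12 ≤ T₁` discarded, the rest inside the one tile). -/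
example : (TileTree.split (2, true) 11 TileTree.offHalf (TileTree.tile 0)).check [toySemi 10 14 10 18] true
    ⟨sextQ 10 10 12 10 10 10, sextQ 11 11 14 18 14 18, 10, 11⟩ = true := by
  decide +kernel

/-- A toy frame as an H-description (row lists empty, as in a 113M unit file). -/
def toyFrameR : StationRowsCert := ⟨1373 / 2000, 687 / 1000, sextQ 10 10 10 10 10 10, sextQ 11 11 14 18 14 18, 10, 11, [], [], []⟩

/-- [finite check, MUST-FAIL at the representative level] a representative whose cover names a tile it does not have fails `Rep.check`
(self-mirror toy cell, half-domain on, no tiles). -/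
example : (⟨⟨19 / 20, 0, 0, 1, 21 / 100, 21 / 100⟩, true, [], TileTree.tile 0⟩ : Rep).check toyFrameR (1 / 500) = false := by
  decide +kernel

end Sanity

end Summit.AtomisticToContinuum.Crystallization.Theorems.ChargedEnergyGapChartDial

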